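import Summits.AtomisticToContinuum.Crystallization.Theorems.LoopTunnelDialFinContact
import Summits.AtomisticToContinuum.Crystallization.Theorems.LoopTunnelDialHotSplit

/-!
# LoopTunnelDial — the range dial on PUSH and LOAD (kit 7d) (lens-5 g19 range dial; crux `PocketCase`, stmt-AtomisticToContinuum-27294)

Kit file 7d (imports 7c and the landed directional split `HotSplit`: HOT ⟸ `PushCost ρ κ` ∧ `LoadCapNP ρ Λ` ∧ slack).  Finite forms `FinPushCost ρ κ R φ`
(relaxed balance; pushers = points closer than `0.89` behind `x` as seen from `q`) and `FinLoadCap ρ Λ R` (no balance: a packing capacity of `h = 2r⁻⁶ − r⁻¹²`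
over the non-pushers in the `R`-ball); bridges `pushCost_of_fin` (exact: pushers lie within `0.89 ≤ R`), `loadCapNP_of_fin` (`Λ ↦ Λ + 12·tailE R`), the
general-tail forms, and the reach `Λ − κ + 12·tailE R ≤ 28.85 ⟹ ContactHotAbove (3/4)` (`R = 8`: `Λ − κ ≤ 23.9`) resp. `Λ − κ + 2τₙ ≤ 28.85 ⟹
ContactHotAbove (3/4)` (`n = 5`: `Λ − κ ≤ 26.4`), given `e⋆ ≤ −0.711`.

Every `def` below is line vocabulary of the LoopTunnelDial contact dial (crux stmt-AtomisticToContinuum-27294), not a cited fact.  0 sorry.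
-/

noncomputable section

namespace Summit.AtomisticToContinuum.Crystallization.Theorems.LoopTunnelDialFinPushLoad

open scoped BigOperators Classical InnerProductSpace
open Literature.MathematicalPhysics.StatisticalMechanics
open Literature.MathematicalPhysics.StatisticalMechanics.Yuhjtman2015 (hLJ)
open Summit.AtomisticToContinuum.Crystallization.Theorems.GrainPercolationDialCrossCeiling (E3 ballChunk)
open Summit.AtomisticToContinuum.Crystallization.Theorems.ChargedEnergyGapNegative (eStar)
open Summit.AtomisticToContinuum.Crystallization.Theorems.OverbindingBudgetCubeTails (sum_inv_pow_six_le_dyadic)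
open Summit.AtomisticToContinuum.Crystallization.Theorems.LoopTunnelDialContactLaw
open Summit.AtomisticToContinuum.Crystallization.Theorems.LoopTunnelDialDepthSep
open Summit.AtomisticToContinuum.Crystallization.Theorems.LoopTunnelDialHotSplit
open Summit.AtomisticToContinuum.Crystallization.Theorems.LoopTunnelDialRangeTails
open Summit.AtomisticToContinuum.Crystallization.Theorems.LoopTunnelDialShellTail
open Summit.AtomisticToContinuum.Crystallization.Theorems.LoopTunnelDialFinContact

variable {N : ℕ}

/-! ### Finite forms of PUSH and LOAD and their bridges (PROVED) -/

/-- Point-level pusher predicate (`IsPusher y p q m = IsPusherPt (y p) (y q) (y m)` definitionally). -/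
def IsPusherPt (x q z : E3) : Prop := dist x z < 89 / 100 ∧ ⟪z - x, q - x⟫_ℝ < 0

/-- The pushers of `x` relative to `q` in the point set `s`. -/
def pushersPt (s : Finset E3) (x q : E3) : Finset E3 := ((s.erase x).erase q).filter (fun z => IsPusherPt x q z)

/-- The non-pushers of `x` relative to `q` in the point set `s`. -/
def nonPushersPt (s : Finset E3) (x q : E3) : Finset E3 := ((s.erase x).erase q).filter (fun z => ¬ IsPusherPt x q z)

/-- **`FinPushCost ρ κ R φ` — FINITE-RANGE PUSH:** in a `7/10`-separated point set inside one closed `R`-ball about `x`, with a partner `q` closer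
than `ρ` and net force on `x` of norm `≤ φ`, the pushers cost at least `κ/12`: `κ ≤ ∑_{pushers} (−h)`.  [TRANSFER · DECIDABLE · INSTRUMENTABLE] -/
def FinPushCost (ρ κ R φ : ℝ) : Prop :=
  ∀ (s : Finset E3) (x q : E3), x ∈ s → q ∈ s → q ≠ x → (∀ z ∈ s, dist x z ≤ R) →
    (∀ z ∈ s, ∀ w ∈ s, z ≠ w → (7 : ℝ) / 10 ≤ dist z w) → dist x q < ρ →
    (∀ e : E3, |∑ z ∈ s.erase x, forceTerm x z e| ≤ φ * ‖e‖) →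
    κ ≤ ∑ z ∈ pushersPt s x q, -hLJ (dist x z)

/-- **`FinLoadCap ρ Λ R` — FINITE-RANGE LOAD:** in a `7/10`-separated point set inside one closed `R`-ball about `x`, with a partner `q` closer
than `ρ`, the non-pushers load at most `Λ`: `∑_{non-pushers} h ≤ Λ` (no force balance: a pure spherical-code capacity). [TRANSFER · DECIDABLE · INSTRUMENTABLE] -/
def FinLoadCap (ρ Λ R : ℝ) : Prop :=
  ∀ (s : Finset E3) (x q : E3), x ∈ s → q ∈ s → q ≠ x → (∀ z ∈ s, dist x z ≤ R) →
    (∀ z ∈ s, ∀ w ∈ s, z ≠ w → (7 : ℝ) / 10 ≤ dist z w) → dist x q < ρ →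
    ∑ z ∈ nonPushersPt s x q, hLJ (dist x z) ≤ Λ

/-- Pushers are near: for `R ≥ 89/100`, the image of `pushers y p q` is `pushersPt` of the truncation. -/
theorem image_pushers_eq {y : Fin N → E3} (hy : Function.Injective y) (p q : Fin N) {R : ℝ} (hR : 89 / 100 ≤ R) :
    (pushers y p q).image y = pushersPt (insert (y p) ((nearIdx R y p).image y)) (y p) (y q) := by
  ext z
  simp only [Finset.mem_image, pushers, pushersPt, Finset.mem_filter, Finset.mem_erase, Finset.mem_insert, Finset.mem_univ,
    IsPusher, IsPusherPt, nearIdx]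
  constructor
  · rintro ⟨m, ⟨⟨hmq, hmp, -⟩, hd, hin⟩, rfl⟩
    refine ⟨⟨fun h => hmq (hy h), fun h => hmp (hy h), Or.inr ⟨m, ⟨⟨hmp, trivial⟩, by linarith⟩, rfl⟩⟩, hd, hin⟩
  · rintro ⟨⟨hzq, hzp, hz⟩, hd, hin⟩
    rcases hz with hz | ⟨m, ⟨⟨hmp, -⟩, hmR⟩, rfl⟩
    · exact absurd hz hzp
    · exact ⟨m, ⟨⟨fun h => hzq (congrArg y h), hmp, trivial⟩, hd, hin⟩, rfl⟩

/-- Near non-pushers: the image of the NEAR non-pushers is `nonPushersPt` of the truncation. -/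
theorem image_nonPushers_near_eq {y : Fin N → E3} (hy : Function.Injective y) (p q : Fin N) (R : ℝ) :
    ((nonPushers y p q).filter (fun m => dist (y p) (y m) ≤ R)).image y =
      nonPushersPt (insert (y p) ((nearIdx R y p).image y)) (y p) (y q) := by
  ext z
  simp only [Finset.mem_image, nonPushers, nonPushersPt, Finset.mem_filter, Finset.mem_erase, Finset.mem_insert, Finset.mem_univ,
    IsPusher, IsPusherPt, nearIdx]
  constructor
  · rintro ⟨m, ⟨⟨⟨hmq, hmp, -⟩, hnp⟩, hmR⟩, rfl⟩
    exact ⟨⟨fun h => hmq (hy h), fun h => hmp (hy h), Or.inr ⟨m, ⟨⟨hmp, trivial⟩, hmR⟩, rfl⟩⟩, hnp⟩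
  · rintro ⟨⟨hzq, hzp, hz⟩, hnp⟩
    rcases hz with hz | ⟨m, ⟨⟨hmp, -⟩, hmR⟩, rfl⟩
    · exact absurd hz hzp
    · exact ⟨m, ⟨⟨⟨fun h => hzq (congrArg y h), hmp, trivial⟩, hnp⟩, hmR⟩, rfl⟩

/-- The FAR non-pushers are exactly the far particles (`R ≥ 89/100`, `q` near). -/
theorem nonPushers_far_eq {y : Fin N → E3} {p q : Fin N} {R : ℝ} (hR : 89 / 100 ≤ R) (hq : dist (y p) (y q) ≤ R) :
    (nonPushers y p q).filter (fun m => ¬ dist (y p) (y m) ≤ R) = farIdx R y p := by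
  ext m
  simp only [nonPushers, farIdx, Finset.mem_filter, Finset.mem_erase, Finset.mem_univ, IsPusher, and_true]
  constructor
  · rintro ⟨⟨⟨-, hmp⟩, -⟩, hfar⟩
    exact ⟨hmp, hfar⟩
  · rintro ⟨hmp, hfar⟩
    refine ⟨⟨⟨fun h => hfar (h ▸ hq), hmp⟩, fun ⟨hd, _⟩ => hfar (by linarith)⟩, hfar⟩

/-- **PUSH ⟸ its finite-range form (PROVED):** `FinPushCost ρ κ R (tailF R) ⟹ PushCost ρ κ` for `1 ≤ R`, `ρ ≤ R` (pushers are all within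
`0.89 < R`; exact force balance leaves a residual `≤ tailF R` on the truncation). -/
theorem pushCost_of_fin {ρ κ R : ℝ} (hR : 1 ≤ R) (hρR : ρ ≤ R) (h : FinPushCost ρ κ R (tailF R)) : PushCost ρ κ := by
  intro N y hy hsep p q hpq hlt hF
  obtain ⟨hx, hserase, hwithin, hssep, -⟩ := truncation_facts hy hsep p (by linarith : (0 : ℝ) ≤ R)
  set s : Finset E3 := insert (y p) ((nearIdx R y p).image y) with hs
  have hsum_image : ∀ (t : Finset (Fin N)) (g : E3 → ℝ), ∑ z ∈ t.image y, g z = ∑ m ∈ t, g (y m) :=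
    fun t g => Finset.sum_image (fun a _ b _ hab => hy hab)
  have hqR : dist (y p) (y q) ≤ R := hlt.le.trans hρR
  have hl : q ∈ nearIdx R y p := Finset.mem_filter.2 ⟨Finset.mem_erase.2 ⟨hpq.symm, Finset.mem_univ _⟩, hqR⟩
  have hq : y q ∈ s := Finset.mem_insert_of_mem (Finset.mem_image_of_mem y hl)
  have hqx : y q ≠ y p := fun hh => hpq (hy hh).symm
  have hforce : ∀ e : E3, |∑ z ∈ s.erase (y p), forceTerm (y p) z e| ≤ tailF R * ‖e‖ := by
    intro e
    rw [hserase, hsum_image _ (fun z => forceTerm (y p) z e)]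
    have h0 := (forceBalancedAt_iff y p).1 hF e
    rw [sum_erase_eq_near_add_far R y p] at h0
    have hnear : ∑ m ∈ nearIdx R y p, forceTerm (y p) (y m) e = -∑ m ∈ farIdx R y p, forceTerm (y p) (y m) e := by linarith
    rw [hnear, abs_neg]
    exact abs_sum_far_forceTerm_le hy hsep p hR e
  have hκ := h s (y p) (y q) hx hq hqx hwithin hssep hlt hforce
  rw [← image_pushers_eq hy p q (by linarith : (89:ℝ) / 100 ≤ R), hsum_image _ (fun z => -hLJ (dist (y p) z))] at hκ
  exact hκ

/-- **LOAD ⟸ its finite-range form (PROVED):** `FinLoadCap ρ Λ R ⟹ LoadCapNP ρ (Λ + 12·tailE R)` for `1 ≤ R`, `ρ ≤ R` (the far particles are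
non-pushers carrying `h = −12V`, at most `12·tailE R` in total). -/
theorem loadCapNP_of_fin {ρ Λ R : ℝ} (hR : 1 ≤ R) (hρR : ρ ≤ R) (h : FinLoadCap ρ Λ R) : LoadCapNP ρ (Λ + 12 * tailE R) := by
  intro N y hy hsep p q hpq hlt
  obtain ⟨hx, hserase, hwithin, hssep, -⟩ := truncation_facts hy hsep p (by linarith : (0 : ℝ) ≤ R)
  set s : Finset E3 := insert (y p) ((nearIdx R y p).image y) with hs
  have hsum_image : ∀ (t : Finset (Fin N)) (g : E3 → ℝ), ∑ z ∈ t.image y, g z = ∑ m ∈ t, g (y m) :=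
    fun t g => Finset.sum_image (fun a _ b _ hab => hy hab)
  have hqR : dist (y p) (y q) ≤ R := hlt.le.trans hρR
  have hl : q ∈ nearIdx R y p := Finset.mem_filter.2 ⟨Finset.mem_erase.2 ⟨hpq.symm, Finset.mem_univ _⟩, hqR⟩
  have hq : y q ∈ s := Finset.mem_insert_of_mem (Finset.mem_image_of_mem y hl)
  have hqx : y q ≠ y p := fun hh => hpq (hy hh).symm
  have hΛ := h s (y p) (y q) hx hq hqx hwithin hssep hlt
  rw [← image_nonPushers_near_eq hy p q R, hsum_image _ (fun z => hLJ (dist (y p) z))] at hΛ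
  rw [← Finset.sum_filter_add_sum_filter_not (nonPushers y p q) (fun m => dist (y p) (y m) ≤ R), nonPushers_far_eq (by linarith) hqR]
  have hfar : ∑ m ∈ farIdx R y p, hLJ (dist (y p) (y m)) ≤ 12 * tailE R := by
    have h1 := sum_far_abs_lennardJones_le hy hsep p hR
    have h2 : ∀ m ∈ farIdx R y p, hLJ (dist (y p) (y m)) ≤ 12 * |lennardJones (dist (y p) (y m))| := by
      intro m _
      have : hLJ (dist (y p) (y m)) = -12 * lennardJones (dist (y p) (y m)) := by rw [lennardJones_eq_hLJ]; ring
      rw [this]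
      have := neg_abs_le (lennardJones (dist (y p) (y m)))
      linarith
    calc ∑ m ∈ farIdx R y p, hLJ (dist (y p) (y m)) ≤ ∑ m ∈ farIdx R y p, 12 * |lennardJones (dist (y p) (y m))| :=
          Finset.sum_le_sum h2
      _ = 12 * ∑ m ∈ farIdx R y p, |lennardJones (dist (y p) (y m))| := (Finset.mul_sum _ _ _).symm
      _ ≤ 12 * tailE R := by linarith
  linarith

/-- **THE FINITE GLUE (PROVED):** `FinPushCost ρ κ R φ ∧ FinLoadCap ρ Λ R ∧ (h ≤ H on [7/10, ρ)) ⟹ FinContactHot ρ (−(H − κ + Λ)/12) R φ`. -/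
theorem finContactHot_of_finPush_finLoad {ρ κ Λ H R φ : ℝ} (hH : ∀ a : ℝ, 7 / 10 ≤ a → a < ρ → hLJ a ≤ H)
    (hP : FinPushCost ρ κ R φ) (hL : FinLoadCap ρ Λ R) : FinContactHot ρ (-(1 / 12) * (H - κ + Λ)) R φ := by
  intro s x q hx hq hqx hin hsep hd hF
  have hq' : q ∈ s.erase x := Finset.mem_erase.2 ⟨hqx, hq⟩
  have hsum : ∑ z ∈ s.erase x, lennardJones (dist x z) = -(1 / 12) * ∑ z ∈ s.erase x, hLJ (dist x z) := by
    simp only [lennardJones_eq_hLJ, Finset.mul_sum]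
  have hsplit : ∑ z ∈ s.erase x, lennardJones (dist x z) =
      -(1 / 12) * (hLJ (dist x q) + ∑ z ∈ pushersPt s x q, hLJ (dist x z) + ∑ z ∈ nonPushersPt s x q, hLJ (dist x z)) := by
    rw [hsum, ← Finset.add_sum_erase _ _ hq']
    unfold pushersPt nonPushersPt
    rw [← Finset.sum_filter_add_sum_filter_not ((s.erase x).erase q) (fun z => IsPusherPt x q z), add_assoc]
  rw [hsplit]
  have h1 : hLJ (dist x q) ≤ H := hH _ (hsep x hx q hq hqx.symm) hd
  have h2 : ∑ z ∈ pushersPt s x q, hLJ (dist x z) ≤ -κ := by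
    have := hP s x q hx hq hqx hin hsep hd hF
    rw [Finset.sum_neg_distrib] at this
    linarith
  have h3 := hL s x q hx hq hqx hin hsep hd
  nlinarith

/-- **STUB 3 ⟸ FINITE PUSH ∧ FINITE LOAD at range `R` (PROVED mod `e⋆ ≤ −0.711`):** `FinPushCost (3/4) κ R (tailF R) ∧ FinLoadCap (3/4) Λ R` with
`Λ − κ + 12·tailE R ≤ 28.85` give HOT at `3/4` — through `FinContactHot` and the bridge (equivalently through `pushCost_of_fin`,
`loadCapNP_of_fin` and generation 18's glue).  At `R = 8`: `12·tailE 8 < 4.92`, so `Λ − κ ≤ 23.9` suffices. -/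
theorem contactHotAbove_threeQuarters_of_finPush_finLoad {κ Λ R : ℝ} (hR : 1 ≤ R) (he : eStar ≤ -(711 / 1000))
    (hP : FinPushCost (3 / 4) κ R (tailF R)) (hL : FinLoadCap (3 / 4) Λ R) (hκΛ : Λ - κ + 12 * tailE R ≤ 2885 / 100) :
    ContactHotAbove (3 / 4) :=
  contactHotAbove_threeQuarters_of_push_load he (pushCost_of_fin hR (by linarith) hP)
    (loadCapNP_of_fin hR (by linarith) hL) (by linarith)

/-! ### General certified tails and the calibrated reach -/

/-- **GENERAL PUSH BRIDGE (PROVED):** `FarTails R E F` (`89/100 ≤ R`, `ρ ≤ R`) and `FinPushCost ρ κ R F` give `PushCost ρ κ`. -/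
theorem pushCost_of_fin_of_farTails {ρ κ R E F : ℝ} (hR : 89 / 100 ≤ R) (hρR : ρ ≤ R) (hT : FarTails R E F)
    (h : FinPushCost ρ κ R F) : PushCost ρ κ := by
  intro N y hy hsep p q hpq hlt hF
  obtain ⟨hx, hserase, hwithin, hssep, -⟩ := truncation_facts hy hsep p (by linarith : (0 : ℝ) ≤ R)
  set s : Finset E3 := insert (y p) ((nearIdx R y p).image y) with hs
  have hsum_image : ∀ (t : Finset (Fin N)) (g : E3 → ℝ), ∑ z ∈ t.image y, g z = ∑ m ∈ t, g (y m) :=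
    fun t g => Finset.sum_image (fun a _ b _ hab => hy hab)
  have hqR : dist (y p) (y q) ≤ R := hlt.le.trans hρR
  have hl : q ∈ nearIdx R y p := Finset.mem_filter.2 ⟨Finset.mem_erase.2 ⟨hpq.symm, Finset.mem_univ _⟩, hqR⟩
  have hq : y q ∈ s := Finset.mem_insert_of_mem (Finset.mem_image_of_mem y hl)
  have hqx : y q ≠ y p := fun hh => hpq (hy hh).symm
  have hforce : ∀ e : E3, |∑ z ∈ s.erase (y p), forceTerm (y p) z e| ≤ F * ‖e‖ := by
    intro e
    rw [hserase, hsum_image _ (fun z => forceTerm (y p) z e)]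
    have h0 := (forceBalancedAt_iff y p).1 hF e
    rw [sum_erase_eq_near_add_far R y p] at h0
    have hnear : ∑ m ∈ nearIdx R y p, forceTerm (y p) (y m) e = -∑ m ∈ farIdx R y p, forceTerm (y p) (y m) e := by linarith
    rw [hnear, abs_neg]
    exact (hT N y hy hsep p).2 e
  have hκ := h s (y p) (y q) hx hq hqx hwithin hssep hlt hforce
  rw [← image_pushers_eq hy p q hR, hsum_image _ (fun z => -hLJ (dist (y p) z))] at hκ
  exact hκ

/-- **GENERAL LOAD BRIDGE (PROVED):** `FarTails R E F` (`89/100 ≤ R`, `ρ ≤ R`) and `FinLoadCap ρ Λ R` give `LoadCapNP ρ (Λ + 12E)`. -/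
theorem loadCapNP_of_fin_of_farTails {ρ Λ R E F : ℝ} (hR : 89 / 100 ≤ R) (hρR : ρ ≤ R) (hT : FarTails R E F)
    (h : FinLoadCap ρ Λ R) : LoadCapNP ρ (Λ + 12 * E) := by
  intro N y hy hsep p q hpq hlt
  obtain ⟨hx, hserase, hwithin, hssep, -⟩ := truncation_facts hy hsep p (by linarith : (0 : ℝ) ≤ R)
  set s : Finset E3 := insert (y p) ((nearIdx R y p).image y) with hs
  have hsum_image : ∀ (t : Finset (Fin N)) (g : E3 → ℝ), ∑ z ∈ t.image y, g z = ∑ m ∈ t, g (y m) :=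
    fun t g => Finset.sum_image (fun a _ b _ hab => hy hab)
  have hqR : dist (y p) (y q) ≤ R := hlt.le.trans hρR
  have hl : q ∈ nearIdx R y p := Finset.mem_filter.2 ⟨Finset.mem_erase.2 ⟨hpq.symm, Finset.mem_univ _⟩, hqR⟩
  have hq : y q ∈ s := Finset.mem_insert_of_mem (Finset.mem_image_of_mem y hl)
  have hqx : y q ≠ y p := fun hh => hpq (hy hh).symm
  have hΛ := h s (y p) (y q) hx hq hqx hwithin hssep hlt
  rw [← image_nonPushers_near_eq hy p q R, hsum_image _ (fun z => hLJ (dist (y p) z))] at hΛ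
  rw [← Finset.sum_filter_add_sum_filter_not (nonPushers y p q) (fun m => dist (y p) (y m) ≤ R), nonPushers_far_eq hR hqR]
  have hfar : ∑ m ∈ farIdx R y p, hLJ (dist (y p) (y m)) ≤ 12 * E := by
    have h1 := (hT N y hy hsep p).1
    have h2 : ∀ m ∈ farIdx R y p, hLJ (dist (y p) (y m)) ≤ 12 * |lennardJones (dist (y p) (y m))| := by
      intro m _
      have : hLJ (dist (y p) (y m)) = -12 * lennardJones (dist (y p) (y m)) := by rw [lennardJones_eq_hLJ]; ring
      rw [this]
      have := neg_abs_le (lennardJones (dist (y p) (y m)))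
      linarith
    calc ∑ m ∈ farIdx R y p, hLJ (dist (y p) (y m)) ≤ ∑ m ∈ farIdx R y p, 12 * |lennardJones (dist (y p) (y m))| :=
          Finset.sum_le_sum h2
      _ = 12 * ∑ m ∈ farIdx R y p, |lennardJones (dist (y p) (y m))| := (Finset.mul_sum _ _ _).symm
      _ ≤ 12 * E := by linarith
  linarith

/-- **STUB 3 ⟸ CALIBRATED FINITE PUSH ∧ LOAD AT RANGE `n ≥ 2` (PROVED mod `e⋆ ≤ −0.711`):** `Λ − κ + 2τₙ ≤ 28.85` suffices
(at `n = 5`: `2τ₅ < 2.4`, so `Λ − κ ≤ 26.4`; at `n = 4`: `Λ − κ ≤ 24.1`). -/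
theorem contactHotAbove_threeQuarters_of_finPush_finLoad_shells {n : ℕ} (hn : 2 ≤ n) {κ Λ : ℝ} (he : eStar ≤ -(711 / 1000))
    (hP : FinPushCost (3 / 4) κ n ((((n : ℝ))⁻¹ + ((n : ℝ))⁻¹ ^ 7) * tauShell n)) (hL : FinLoadCap (3 / 4) Λ n)
    (hκΛ : Λ - κ + 2 * tauShell n ≤ 2885 / 100) : ContactHotAbove (3 / 4) := by
  have hn' : (2 : ℝ) ≤ n := by exact_mod_cast hn
  have hT := farTails_shells hn
  exact contactHotAbove_threeQuarters_of_push_load he (pushCost_of_fin_of_farTails (by linarith) (by linarith) hT hP)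
    (loadCapNP_of_fin_of_farTails (by linarith) (by linarith) hT hL) (by linarith)

end Summit.AtomisticToContinuum.Crystallization.Theorems.LoopTunnelDialFinPushLoad
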